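import Literature.NumberTheory.Automorphic.CompletedCohomologyGL
import Mathlib.RingTheory.FreeRing
import HarnessLib

/-!
# Noncommutative polynomials in Hecke operators: the big Hecke algebra versus finite level

Topic `NumberTheory/Automorphic`; namespace `Literature.NumberTheory.Automorphic`, grouping
sub-namespaces `ArithmeticQuotient` (function model `Fun(𝒢 ⧸ L, M)`) and `BigHeckeGLn`
(the dual model `Dual k[GL_n(𝔸_K^∞)/U]` of `CompletedCohomologyHeckeAlgebraGLn`).  Definitions
with bodies and theorems; no named fact.

The big Hecke algebra `𝕋(K^p) = CompletedCohomologyHeckeAlgebraGLn 𝒰` is the closure of the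
subring of `∏_{(r,s,i)} End(Hⁱ(X_{U_r}, ℤ/p^s))` generated by the families
`𝒰.heckeOperator t` of Hecke operators; an element of that subring is a noncommutative
polynomial `Q` (an element of the free ring `FreeRing I`) evaluated at generators `t : I → G`.
This file computes the `(r, s, i)`-component of such an evaluation as `Hⁱ` of the SAME polynomial
evaluated in the coefficient representation of level `U_r` — in the dual model
(`BigHeckeGLn.heckePolyLevel`, `TameLevel.freeRingLift_heckeOperator_apply`) and, through the
tree's comparison isomorphism `coeffRepIso` (`CompletedCohomologyGL`), in the function model
(`ArithmeticQuotient.heckePoly`, `heckePoly_comp_coeffRepIso_hom`,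
**`TameLevel.freeRingLift_heckeOperator_apply_eq_zero_iff`**: the component vanishes iff
`Hⁱ(GL_n K, Q([U_r tᵢ U_r])) = 0` on `Hⁱ(GL_n K, Fun(GL_n(𝔸_K^∞)/U_r, ℤ/p^s))`).  This is the
dictionary needed to feed "`T ∈ 𝕋` vanishes in the factors `(r, s, ≤ q)`" (a neighbourhood of `0`
in `𝕋(K^p)`) into the level-change / Hochschild–Serre step of
[Scholze2015, §V.4, proof of Thm. V.4.1 and of Cor. V.4.2].

Also: `freeRingLift_comp_iso_hom` — two evaluations of polynomials intertwined on generators by an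
isomorphism are intertwined (generic, any preadditive category).

## References

* P. Scholze, Ann. of Math. 182 (2015), §V.4 [Scholze2015].
* T. Gee, J. Newton, *Patching and the completed homology of locally symmetric spaces*,
  J. Inst. Math. Jussieu (2020), §2.1 [GeeNewton2020].
-/

noncomputable section

open CategoryTheory IsDedekindDomain

namespace Literature.NumberTheory.Automorphic

/-! ### Polynomials intertwined by an isomorphism -/

section Generic

universe v' u'

variable {C : Type u'} [Category.{v'} C] [Preadditive C] {X Y : C} {I : Type*}

/-- If two evaluations `P : FreeRing I → End X`, `P' : FreeRing I → End Y` of noncommutative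
polynomials are intertwined by `e : X ⟶ Y` on the generators, they are intertwined:
`P(Q) ≫ e = e ≫ P'(Q)`. [folklore] -/
theorem freeRingLift_comp_hom (P : FreeRing I →+* End X) (P' : FreeRing I →+* End Y) (e : X ⟶ Y)
    (h : ∀ i : I, P (FreeRing.of i) ≫ e = e ≫ P' (FreeRing.of i)) (Q : FreeRing I) :
    P Q ≫ e = e ≫ P' Q := by
  induction Q using FreeRing.induction_on with
  | hn1 =>
    rw [map_neg, map_one, map_neg, map_one]
    change (-𝟙 X) ≫ e = e ≫ (-𝟙 Y)
    rw [Preadditive.neg_comp, Preadditive.comp_neg, Category.id_comp, Category.comp_id]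
  | hb i => exact h i
  | ha x y hx hy =>
    rw [map_add, map_add]
    calc (P x + P y) ≫ e = P x ≫ e + P y ≫ e := Preadditive.add_comp _ _ _ _ _ _
      _ = e ≫ P' x + e ≫ P' y := by rw [hx, hy]
      _ = e ≫ (P' x + P' y) := (Preadditive.comp_add _ _ _ _ _ _).symm
  | hm x y hx hy => rw [map_mul, map_mul, End.mul_def, End.mul_def, Category.assoc, hx,
      ← Category.assoc, hy, Category.assoc]

/-- The same for an isomorphism, in conjugation form: `P'(Q) = e⁻¹ ≫ P(Q) ≫ e`. [folklore] -/
theorem freeRingLift_eq_conj (P : FreeRing I →+* End X) (P' : FreeRing I →+* End Y) (e : X ≅ Y)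
    (h : ∀ i : I, P (FreeRing.of i) ≫ e.hom = e.hom ≫ P' (FreeRing.of i)) (Q : FreeRing I) :
    P' Q = e.inv ≫ P Q ≫ e.hom := by
  rw [freeRingLift_comp_hom P P' e.hom h Q, Iso.inv_hom_id_assoc]

end Generic

/-! ### The function model: `ArithmeticQuotient.heckePoly` -/

namespace ArithmeticQuotient

universe u

variable (k : Type u) [CommRing k] {Γ 𝒢 : Type u} [Group Γ] [Group 𝒢] (ι : Γ →* 𝒢)
  (L : Subgroup 𝒢) (M : Type u) [AddCommGroup M] [Module k M] {I : Type*} (t : I → 𝒢)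

/-- Evaluation of noncommutative polynomials over `ℤ` (elements of the free ring on `I`) at the
Hecke operators `[L tᵢ L]` on `Fun(𝒢 ⧸ L, M)`. [folklore] -/
def heckePoly : FreeRing I →+* End (coeffRep k ι L M) :=
  FreeRing.lift fun i => heckeRepHom k L (t i) M ι

/-- `heckePoly` on a generator. [folklore] -/
@[simp]
theorem heckePoly_of (i : I) : heckePoly k ι L M t (FreeRing.of i) = heckeRepHom k L (t i) M ι :=
  FreeRing.lift_of _ _

end ArithmeticQuotient

/-! ### The dual model and the big Hecke algebra -/

namespace BigHeckeGLn

variable {n : ℕ} {K : Type} [Field K] [NumberField K]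

section Level

variable (U : Subgroup (FiniteAdelicGL n K)) (k : Type) [CommRing k]

/-- `Hⁱ` of an endomorphism of the level-`U` coefficients, as a ring homomorphism
`End(Dual k[G/U]) → End_k(Hⁱ(X_U, k))` (functoriality of `groupCohomology`; additivity through
`cochainsFunctor`). [folklore] -/
def levelCohomologyEndHom (i : ℕ) :
    End (Rep.of (levelRep U k)) →+* Module.End k (levelCohomology U k i) where
  toFun φ := ((groupCohomology.functor k (GL (Fin n) K) i).map φ).hom
  map_one' := by
    rw [End.one_def, CategoryTheory.Functor.map_id]
    rfl
  map_mul' φ ψ := by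
    rw [End.mul_def, CategoryTheory.Functor.map_comp, ModuleCat.hom_comp]
    rfl
  map_zero' := by
    change ((groupCohomology.functor k (GL (Fin n) K) i).map
      (0 : Rep.of (levelRep U k) ⟶ Rep.of (levelRep U k))).hom = 0
    rw [Functor.map_zero]
    rfl
  map_add' φ ψ := by
    have h : ((groupCohomology.functor k (GL (Fin n) K) i).map (φ + ψ)).hom =
        (HomologicalComplex.homologyMap
          ((groupCohomology.cochainsFunctor k (GL (Fin n) K)).map φ +
            (groupCohomology.cochainsFunctor k (GL (Fin n) K)).map ψ) i).hom :=
      congrArg (fun T => ModuleCat.Hom.hom (HomologicalComplex.homologyMap T i))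
        ((groupCohomology.cochainsFunctor k (GL (Fin n) K)).map_add (f := φ) (g := ψ))
    rw [HomologicalComplex.homologyMap_add, ModuleCat.hom_add] at h
    exact h

/-- Unfolding lemma for `levelCohomologyEndHom`. [folklore] -/
theorem levelCohomologyEndHom_apply (i : ℕ) (φ : End (Rep.of (levelRep U k))) :
    levelCohomologyEndHom U k i φ = ((groupCohomology.functor k (GL (Fin n) K) i).map φ).hom :=
  rfl

variable [IsHeckeTriple (⊤ : Submonoid (FiniteAdelicGL n K)) U U] {I : Type*}
  (t : I → FiniteAdelicGL n K)

/-- `Hⁱ([U g U]) = heckeOnCohomology U k g i`. [folklore] -/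
theorem levelCohomologyEndHom_heckeIntertwining (i : ℕ) (g : FiniteAdelicGL n K) :
    levelCohomologyEndHom U k i (Rep.ofHom (heckeIntertwining U k g)) =
      heckeOnCohomology U k g i :=
  rfl

/-- Evaluation of noncommutative polynomials at the Hecke operators `[U tᵢ U]` on
`Dual k[GL_n(𝔸_K^∞)/U]` (`heckeIntertwining`). [folklore] -/
def heckePolyLevel : FreeRing I →+* End (Rep.of (levelRep U k)) :=
  FreeRing.lift fun i => Rep.ofHom (heckeIntertwining U k (t i))

/-- `heckePolyLevel` on a generator. [folklore] -/
@[simp]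
theorem heckePolyLevel_of (i : I) :
    heckePolyLevel U k t (FreeRing.of i) = Rep.ofHom (heckeIntertwining U k (t i)) :=
  FreeRing.lift_of _ _

/-- **The two models agree on polynomials**: `coeffRepIso` intertwines `heckePoly` (function
model, `ArithmeticQuotient.heckeFun`) and `heckePolyLevel` (dual model). [folklore] -/
theorem heckePoly_comp_coeffRepIso_hom (Q : FreeRing I) :
    ArithmeticQuotient.heckePoly k (globalEmbedding n K) U k t Q ≫ (coeffRepIso U k).hom =
      (coeffRepIso U k).hom ≫ heckePolyLevel U k t Q :=
  freeRingLift_comp_hom _ _ _ (fun i => by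
    rw [ArithmeticQuotient.heckePoly_of, heckePolyLevel_of]
    exact heckeRepHom_comp_coeffRepIso_hom U k (t i)) Q

end Level

namespace TameLevel

variable {p : ℕ} [Fact p.Prime] (𝒰 : TameLevel n K p) {I : Type*} (t : I → FiniteAdelicGL n K)

/-- **The components of a polynomial in the `𝒰.heckeOperator tⱼ`**: the `(r, s, i)`-component
of `Q((𝒰.heckeOperator tⱼ)ⱼ) ∈ ∏ End(Hⁱ(X_{U_r}, ℤ/p^s))` is `Hⁱ` of `Q` evaluated at the
`[U_r tⱼ U_r]` on the level-`U_r` coefficients `Dual (ℤ/p^s)[G/U_r]`.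
[cite: GeeNewton2020, §2.1.3] -/
theorem freeRingLift_heckeOperator_apply (Q : FreeRing I) (r s i : ℕ) :
    (FreeRing.lift (fun j => 𝒰.heckeOperator (t j)) Q (r, s, i) :
        Module.End (ZMod (p ^ s)) (levelCohomology (𝒰.tower r) (ZMod (p ^ s)) i)) =
      levelCohomologyEndHom (𝒰.tower r) (ZMod (p ^ s)) i
        (heckePolyLevel (𝒰.tower r) (ZMod (p ^ s)) t Q) := by
  have h1 : FreeRing.lift (fun j => 𝒰.heckeOperator (t j)) Q (r, s, i) =
      FreeRing.lift (fun j => 𝒰.heckeOperator (t j) (r, s, i)) Q :=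
    DFunLike.congr_fun (FreeRing.hom_ext
      (f := (Pi.evalRingHom (fun idx => 𝒰.EndFactor idx) (r, s, i)).comp
        (FreeRing.lift fun j => 𝒰.heckeOperator (t j)))
      (g := FreeRing.lift fun j => 𝒰.heckeOperator (t j) (r, s, i)) fun j => by
        rw [RingHom.comp_apply, FreeRing.lift_of, FreeRing.lift_of, Pi.evalRingHom_apply]) Q
  rw [h1]
  refine Eq.trans ?_ (DFunLike.congr_fun (FreeRing.hom_ext
    (f := FreeRing.lift fun j => heckeOnCohomology (𝒰.tower r) (ZMod (p ^ s)) (t j) i)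
    (g := (levelCohomologyEndHom (𝒰.tower r) (ZMod (p ^ s)) i).comp
      (heckePolyLevel (𝒰.tower r) (ZMod (p ^ s)) t)) fun j => ?_) Q)
  · rfl
  · rw [RingHom.comp_apply, heckePolyLevel_of, levelCohomologyEndHom_heckeIntertwining,
      FreeRing.lift_of]

/-- **Vanishing of a component of `Q((𝒰.heckeOperator tⱼ)ⱼ)`** is the vanishing of
`Hⁱ(GL_n K, Q([U_r tⱼ U_r]))` on `Hⁱ(GL_n K, Fun(GL_n(𝔸_K^∞)/U_r, ℤ/p^s))` in the function model
(`ArithmeticQuotient.heckePoly`). [cite: Scholze2015, §V.4, proof of Cor. V.4.2] -/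
theorem freeRingLift_heckeOperator_apply_eq_zero_iff (Q : FreeRing I) (r s i : ℕ) :
    FreeRing.lift (fun j => 𝒰.heckeOperator (t j)) Q (r, s, i) = 0 ↔
      groupCohomology.map
        (A := ArithmeticQuotient.coeffRep (ZMod (p ^ s)) (globalEmbedding n K) (𝒰.tower r)
          (ZMod (p ^ s))) (MonoidHom.id (GL (Fin n) K))
        (ArithmeticQuotient.heckePoly (ZMod (p ^ s)) (globalEmbedding n K) (𝒰.tower r)
          (ZMod (p ^ s)) t Q) i = 0 := by
  rw [show FreeRing.lift (fun j => 𝒰.heckeOperator (t j)) Q (r, s, i) = 0 ↔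
      (FreeRing.lift (fun j => 𝒰.heckeOperator (t j)) Q (r, s, i) :
        Module.End (ZMod (p ^ s)) (levelCohomology (𝒰.tower r) (ZMod (p ^ s)) i)) = 0 from Iff.rfl,
    freeRingLift_heckeOperator_apply, levelCohomologyEndHom_apply]
  have key : (groupCohomology.functor (ZMod (p ^ s)) (GL (Fin n) K) i).map
      (heckePolyLevel (𝒰.tower r) (ZMod (p ^ s)) t Q) =
    ((groupCohomology.functor (ZMod (p ^ s)) (GL (Fin n) K) i).mapIso
        (coeffRepIso (𝒰.tower r) (ZMod (p ^ s)))).inv ≫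
      (groupCohomology.functor (ZMod (p ^ s)) (GL (Fin n) K) i).map
        (ArithmeticQuotient.heckePoly (ZMod (p ^ s)) (globalEmbedding n K) (𝒰.tower r)
          (ZMod (p ^ s)) t Q) ≫
      ((groupCohomology.functor (ZMod (p ^ s)) (GL (Fin n) K) i).mapIso
        (coeffRepIso (𝒰.tower r) (ZMod (p ^ s)))).hom := by
    rw [freeRingLift_eq_conj _ _ (coeffRepIso (𝒰.tower r) (ZMod (p ^ s))) (fun j => by
        rw [ArithmeticQuotient.heckePoly_of, heckePolyLevel_of]
        exact heckeRepHom_comp_coeffRepIso_hom (𝒰.tower r) (ZMod (p ^ s)) (t j)) Q,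
      CategoryTheory.Functor.map_comp, CategoryTheory.Functor.map_comp]
    rfl
  constructor
  · intro h0
    have h1 : (groupCohomology.functor (ZMod (p ^ s)) (GL (Fin n) K) i).map
        (heckePolyLevel (𝒰.tower r) (ZMod (p ^ s)) t Q) = 0 :=
      ModuleCat.hom_ext (by rw [ModuleCat.hom_zero]; exact h0)
    have h2 : (groupCohomology.functor (ZMod (p ^ s)) (GL (Fin n) K) i).map
        (ArithmeticQuotient.heckePoly (ZMod (p ^ s)) (globalEmbedding n K) (𝒰.tower r)
          (ZMod (p ^ s)) t Q) =
      ((groupCohomology.functor (ZMod (p ^ s)) (GL (Fin n) K) i).mapIso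
          (coeffRepIso (𝒰.tower r) (ZMod (p ^ s)))).hom ≫
        (groupCohomology.functor (ZMod (p ^ s)) (GL (Fin n) K) i).map
          (heckePolyLevel (𝒰.tower r) (ZMod (p ^ s)) t Q) ≫
        ((groupCohomology.functor (ZMod (p ^ s)) (GL (Fin n) K) i).mapIso
          (coeffRepIso (𝒰.tower r) (ZMod (p ^ s)))).inv := by
      rw [key]
      simp only [Category.assoc, Iso.hom_inv_id_assoc, Iso.hom_inv_id, Category.comp_id]
    change (groupCohomology.functor (ZMod (p ^ s)) (GL (Fin n) K) i).map _ = 0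
    rw [h2, h1, Limits.zero_comp, Limits.comp_zero]
  · intro h1
    change (groupCohomology.functor (ZMod (p ^ s)) (GL (Fin n) K) i).map _ = 0 at h1
    rw [key, h1, Limits.zero_comp, Limits.comp_zero, ModuleCat.hom_zero]
    rfl

end TameLevel

end BigHeckeGLn

end Literature.NumberTheory.Automorphic
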